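import Mathlib
import HarnessLib
import Literature.Computability.AlgebraicComplexity.PatternExpressions
import Literature.Combinatorics.SimpleGraph.TreeDecompositionRooting
import Literature.LinearAlgebra.TensorNetworks.JunctionTree
import Summits.ValiantsHypothesis.ValiantsHypothesis.Theorems.MonotoneRestorationOrbitRestorationQPBagLabelling
import Summits.ValiantsHypothesis.ValiantsHypothesis.Theorems.MonotoneRestorationOrbitRestorationQPHomPolyCloseDP
import Summits.ValiantsHypothesis.ValiantsHypothesis.Theorems.MonotoneRestorationOrbitRestorationQPSplitKThree

/-!
# Route MonotoneRestoration — crux `OrbitRestorationQP` (stmt-ValiantsHypothesis-18293), sub-crux K2 `HomPolyClose`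
# Step 3–4: homomorphism polynomials of bounded-treewidth patterns are closed labelled pattern expressions

The archived stub `stub_homPoly_close` of line `narrow-expansion` (K2, "folklore bridge", the statement
that `Literature/Computability/AlgebraicComplexity/PatternExpressions.lean` records as "folklore and not
formalised here"), verbatim, PROVED:

  for every bipartite multigraph pattern `E : Multiset (Fin a × Fin b)` whose pattern graph on
  `Fin a ⊕ Fin b` has treewidth `≤ w`, every `n ≥ 1` and all `k, l ≥ w + 1`, there is a labelled pattern
  expression `e : PatternExpr ℂ k l` with `e.close n = homPoly E n ℂ`.

Consequently the counting-width split of the crux (`orbitRestorationQP_of_narrowExpansion_of_homPolyClose`,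
K3 already discharged by `stub_close_orbit`) has ONE binder left:
**`orbitRestorationQP_of_narrowExpansionVP : NarrowExpansionVP → OrbitRestorationQP`** — the crux
`OrbitRestorationQP` follows from the narrow hom-expansion statement K1 alone (K1 is conjecture-grade, the
finite-model-theory content: DawarPagoSeppelt2025 Thm 1.1 at quasi-polynomial scale; VP ≠ VNP is not moved).

Proof of K2.  Number the vertices `inl p ↦ p`, `inr q ↦ a + q`; take a rooted tree decomposition in list
form with bags of size `≤ w + 1` (`exists_isRootedTD_of_treewidth_le`), a bag-injective labelling
`lab ≤ w` of the vertices (`exists_bag_labelling`, step 1); registers: row vertex `v` reads row label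
`lab v`, column vertex `v` reads column label `lab v`.  The abstract junction-tree construction
(`exists_expr_val_eq_sum`, step 2) in the model "`PatternExpr`, `value`, `sumRow`/`sumCol`, `mul`,
`const 1`, `edge`" yields an expression whose value at EVERY label assignment is
`Σ_{g ∈ assignments} ∏_{(i,j) ∈ E} x_{g i, g j}`; this sum is `homPoly E n` (`sum_assignments_eq_homPoly`,
reindexing assignments `ℕ → ℕ` by pairs of maps `Fin a → Fin n`, `Fin b → Fin n`); closing multiplies by
the number `n^(k+l)` of label assignments, which the constant `(n^(k+l))⁻¹` absorbs (`1 ≤ n`, char 0).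

* `exists_patternExpr_value_eq_sum` (steps 1–2 instantiated), `sum_assignments_eq_homPoly` (step 3),
  `exists_close_eq_homPoly` (any field of characteristic `0`), **`stub_homPoly_close`** (K2 verbatim),
  **`orbitRestorationQP_of_narrowExpansionVP`** (crux ⟸ K1).

## References
* A. Dawar, B. Pago, T. Seppelt, *Symmetric algebraic circuits and homomorphism polynomials*,
  arXiv:2502.06740 (2025), §5 (proof of Thm 5.3), Thm 1.1. [DawarPagoSeppelt2025]
* L. Lovász, *Large networks and graph limits*, AMS 2012, §6.5 (k-labelled quantum graphs, tree-width).
* H. Dell, M. Grohe, G. Rattan, *Lovász meets Weisfeiler and Leman*, ICALP 2018, Lem. 9.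
-/

noncomputable section

-- `Summit.ValiantsHypothesis.ValiantsHypothesis.…` is the tree's single-conjunct layout (Sub = Summit).
set_option linter.dupNamespace false

namespace Summit.ValiantsHypothesis.ValiantsHypothesis.Theorems.OrbitRestorationQPHomPolyClose

open MvPolynomial Literature.Computability.AlgebraicComplexity
open Literature.Combinatorics.SimpleGraph Literature.Combinatorics.SimpleGraph.ListTD
open Literature.LinearAlgebra.TensorNetworks.JT

/-! ### Steps 1–2 instantiated: an expression with constant value `Σ_g ∏ x_{g i, g j}` -/

/-- **The junction-tree expression for a coded edge list.** Given a rooted tree decomposition (list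
form) of the variables `< nv`, a bag-injective labelling `lab` with labels `< k` and `< l`, and edges
`(i, j)` with `i < a ≤ j` (row vertex `i` reads ROW register `lab i`, column vertex `j` reads COLUMN
register `lab j`) each housed in a bag, there is a labelled pattern expression whose value at every
label assignment is `Σ_{g ∈ assignments (range nv) n} ∏_{(i,j)} x_{g i, g j}` (`n ≥ 1`; values read
mod `n`). [folklore] -/
theorem exists_patternExpr_value_eq_sum {F : Type} [CommSemiring F] {n : ℕ} (hn : 0 < n)
    (a k l nv : ℕ) {par : List ℕ} {bags : List (List ℕ)} (hD : IsRootedTD nv par bags)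
    (lab : ℕ → ℕ) (hk : ∀ v, lab v < k) (hl : ∀ v, lab v < l)
    (hinj : ∀ t, (bagOf bags t).Pairwise fun u v => lab u ≠ lab v)
    (es : List (ℕ × ℕ)) (hes : ∀ e ∈ es, e.1 < a ∧ ¬ e.2 < a)
    (hcov : ∀ e ∈ es, ∃ t, t < bags.length ∧ e.1 ∈ bagOf bags t ∧ e.2 ∈ bagOf bags t) :
    ∃ ex : PatternExpr F k l, ∀ (ρ : Fin k → Fin n) (γ : Fin l → Fin n),
      ex.value n ρ γ = ∑ g ∈ assignments (Finset.range nv) n,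
        (es.map fun e => (X (⟨g e.1 % n, Nat.mod_lt _ hn⟩, ⟨g e.2 % n, Nat.mod_lt _ hn⟩) :
          MvPolynomial (Fin n × Fin n) F)).prod := by
  classical
  -- the model
  set fo : ℕ → Fin n := fun x => ⟨x % n, Nat.mod_lt _ hn⟩ with hfo
  have hfo_val : ∀ y : Fin n, fo y = y := fun y => Fin.ext (Nat.mod_eq_of_lt y.isLt)
  have hfo_lt : ∀ x, x < n → (fo x : ℕ) = x := fun x hx => Nat.mod_eq_of_lt hx
  set Lr : ℕ → Fin k := fun v => ⟨lab v, hk v⟩ with hLr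
  set Lc : ℕ → Fin l := fun v => ⟨lab v, hl v⟩ with hLc
  set val : PatternExpr F k l → (Fin k → Fin n) × (Fin l → Fin n) → MvPolynomial (Fin n × Fin n) F :=
    fun e st => e.value n st.1 st.2 with hval
  set r : (Fin k → Fin n) × (Fin l → Fin n) → ℕ → ℕ :=
    fun st v => if v < a then (st.1 (Lr v) : ℕ) else (st.2 (Lc v) : ℕ) with hr
  set U : (Fin k → Fin n) × (Fin l → Fin n) → ℕ → ℕ → (Fin k → Fin n) × (Fin l → Fin n) :=
    fun st v x => if v < a then (Function.update st.1 (Lr v) (fo x), st.2)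
      else (st.1, Function.update st.2 (Lc v) (fo x)) with hU
  set W : ℕ → PatternExpr F k l → PatternExpr F k l :=
    fun v e => if v < a then PatternExpr.sumRow (Lr v) e else PatternExpr.sumCol (Lc v) e with hW
  set fe : ℕ × ℕ → (ℕ → ℕ) → MvPolynomial (Fin n × Fin n) F :=
    fun e g => X (fo (g e.1), fo (g e.2)) with hfe
  set ee : ℕ × ℕ → PatternExpr F k l := fun e => PatternExpr.edge (Lr e.1) (Lc e.2) with hee
  set scope : ℕ × ℕ → List ℕ := fun e => [e.1, e.2] with hscope
  -- the hypotheses of the abstract construction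
  have HW : ∀ v e st, val (W v e) st = ∑ x ∈ Finset.range n, val e (U st v x) := by
    intro v e st
    by_cases hv : v < a
    · simp only [hval, hW, hU, if_pos hv, PatternExpr.value_sumRow]
      rw [← Fin.sum_univ_eq_sum_range (fun x => PatternExpr.value n e (Function.update st.1 (Lr v) (fo x)) st.2)]
      exact Finset.sum_congr rfl fun y _ => by rw [hfo_val]
    · simp only [hval, hW, hU, if_neg hv, PatternExpr.value_sumCol]
      rw [← Fin.sum_univ_eq_sum_range (fun x => PatternExpr.value n e st.1 (Function.update st.2 (Lc v) (fo x)))]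
      exact Finset.sum_congr rfl fun y _ => by rw [hfo_val]
  have Hmul : ∀ e₁ e₂ st, val (PatternExpr.mul e₁ e₂) st = val e₁ st * val e₂ st := fun _ _ _ => rfl
  have Hone : ∀ st, val (PatternExpr.const 1) st = 1 := fun st => by
    simp only [hval, PatternExpr.value_const, map_one]
  have Hee : ∀ e ∈ es, ∀ st, val (ee e) st = fe e (r st) := by
    intro e he st
    obtain ⟨h1, h2⟩ := hes e he
    simp only [hval, hee, hfe, hr, PatternExpr.value_edge, if_pos h1, if_neg h2, hfo_val]
  have Hloc : ∀ e ∈ es, ∀ g g' : ℕ → ℕ, (∀ v ∈ scope e, g v = g' v) → fe e g = fe e g' := by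
    intro e _ g g' hgg'
    simp only [hfe, hgg' e.1 (by simp [hscope]), hgg' e.2 (by simp [hscope])]
  have HU : ∀ t st, ∀ u ∈ bagOf bags t, ∀ v ∈ bagOf bags t, ∀ x, x < n →
      r (U st v x) u = if u = v then x else r st u := by
    intro t st u hu v hv x hx
    have hne : u ≠ v → lab u ≠ lab v := fun huv =>
      have : Std.Symm (fun u v : ℕ => lab u ≠ lab v) := ⟨fun _ _ h => Ne.symm h⟩
      (hinj t).forall hu hv huv
    by_cases huv : u = v
    · subst huv
      by_cases hu' : u < a
      · simp [hr, hU, if_pos hu', hfo_lt x hx]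
      · simp [hr, hU, if_neg hu', hfo_lt x hx]
    · rw [if_neg huv]
      have hlab := hne huv
      by_cases hv' : v < a <;> by_cases hu' : u < a
      · have hL : Lr u ≠ Lr v := fun h => hlab (by simpa [hLr] using congrArg Fin.val h)
        simp [hr, hU, if_pos hv', if_pos hu', Function.update_of_ne hL]
      · simp [hr, hU, if_pos hv', if_neg hu']
      · simp [hr, hU, if_neg hv', if_pos hu']
      · have hL : Lc u ≠ Lc v := fun h => hlab (by simpa [hLc] using congrArg Fin.val h)
        simp [hr, hU, if_neg hv', if_neg hu', Function.update_of_ne hL]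
  have Hhome : ∀ e ∈ es, homeOf bags (scope e) < bags.length := by
    intro e he
    obtain ⟨t, ht, h1, h2⟩ := hcov e he
    rw [homeOf_lt_length_iff]
    refine ⟨bags[t], List.getElem_mem ht, fun v hv => ?_⟩
    rw [← bagOf_eq_getElem ht]
    simp only [hscope, List.mem_cons, List.not_mem_nil, or_false] at hv
    rcases hv with rfl | rfl
    · exact h1
    · exact h2
  obtain ⟨ex, hex⟩ := exists_expr_val_eq_sum (val := val) (r := r) (d := n) (nv := nv) (par := par)
    (bags := bags) (scope := scope) (fe := fe) (fs := es) W U PatternExpr.mul (PatternExpr.const 1) ee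
    hD HW Hmul Hone Hee Hloc HU Hhome
  exact ⟨ex, fun ρ γ => hex (ρ, γ)⟩

/-! ### Step 3: the sum over assignments is the homomorphism polynomial -/

/-- **Reindexing**: with the vertices numbered `inl p ↦ p`, `inr q ↦ a + q`, the sum over the
assignments `ℕ → ℕ` (values `< n` on `range (a + b)`, `0` elsewhere) of `∏_{(p,q) ∈ E} x_{g p, g (a+q)}`
is the homomorphism polynomial `hom_{E,n}`. [folklore] -/
theorem sum_assignments_eq_homPoly {F : Type} [CommSemiring F] {n : ℕ} (hn : 0 < n) (a b : ℕ)
    (E : Multiset (Fin a × Fin b)) :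
    ∑ g ∈ assignments (Finset.range (a + b)) n,
        ((E.toList.map fun e : Fin a × Fin b => ((e.1 : ℕ), a + (e.2 : ℕ))).map fun e =>
          (X (⟨g e.1 % n, Nat.mod_lt _ hn⟩, ⟨g e.2 % n, Nat.mod_lt _ hn⟩) :
            MvPolynomial (Fin n × Fin n) F)).prod = homPoly E n F := by
  classical
  set fo : ℕ → Fin n := fun x => ⟨x % n, Nat.mod_lt _ hn⟩ with hfo
  have hfo_val : ∀ y : Fin n, fo y = y := fun y => Fin.ext (Nat.mod_eq_of_lt y.isLt)
  have hfo_lt : ∀ x, x < n → (fo x : ℕ) = x := fun x hx => Nat.mod_eq_of_lt hx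
  -- the coding of pairs of maps by assignments and back
  set Ψ : (Fin a → Fin n) × (Fin b → Fin n) → (ℕ → ℕ) := fun h v =>
    if hv : v < a then (h.1 ⟨v, hv⟩ : ℕ) else if hv' : v < a + b then (h.2 ⟨v - a, by omega⟩ : ℕ) else 0
    with hΨ
  set Θ : (ℕ → ℕ) → (Fin a → Fin n) × (Fin b → Fin n) :=
    fun g => (fun p => fo (g p), fun q => fo (g (a + q))) with hΘ
  have hΨ1 : ∀ h (p : Fin a), Ψ h p = h.1 p := fun h p => by simp [hΨ, p.isLt]
  have hΨ2 : ∀ h (q : Fin b), Ψ h (a + q) = h.2 q := fun h q => by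
    have h1 : ¬ (a + (q : ℕ) < a) := by omega
    have h2 : a + (q : ℕ) < a + b := by omega
    simp only [hΨ, h1, dite_false, h2, dite_true]
    congr 2
    exact Fin.ext (by simp)
  unfold homPoly
  symm
  refine Finset.sum_nbij' Ψ Θ (fun h _ => ?_) (fun g _ => Finset.mem_univ _) (fun h _ => ?_)
    (fun g hg => ?_) (fun h _ => ?_)
  · -- `Ψ h` is an assignment
    rw [mem_assignments]
    refine ⟨fun v hv => ?_, fun v hv => ?_⟩
    · rw [Finset.mem_range] at hv
      by_cases h1 : v < a
      · simp only [hΨ, h1, dite_true]; exact Fin.isLt _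
      · simp only [hΨ, h1, dite_false, hv, dite_true]; exact Fin.isLt _
    · rw [Finset.mem_range, not_lt] at hv
      have h1 : ¬ v < a := by omega
      have h2 : ¬ v < a + b := by omega
      simp only [hΨ, h1, dite_false, h2]
  · -- `Θ (Ψ h) = h`
    obtain ⟨h₁, h₂⟩ := h
    simp only [hΘ, Prod.mk.injEq]
    exact ⟨funext fun p => by rw [hΨ1, hfo_val], funext fun q => by rw [hΨ2, hfo_val]⟩
  · -- `Ψ (Θ g) = g` on assignments
    obtain ⟨hg1, hg2⟩ := mem_assignments.1 hg
    funext v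
    by_cases h1 : v < a
    · have := hΨ1 (Θ g) ⟨v, h1⟩
      simp only at this
      rw [this]
      simp only [hΘ]
      exact hfo_lt _ (hg1 v (Finset.mem_range.2 (by omega)))
    · by_cases h2 : v < a + b
      · have := hΨ2 (Θ g) ⟨v - a, by omega⟩
        simp only [show a + (v - a) = v by omega] at this
        rw [this]
        simp only [hΘ]
        rw [show a + (v - a) = v by omega]
        exact hfo_lt _ (hg1 v (Finset.mem_range.2 h2))
      · have h3 : v ∉ Finset.range (a + b) := by simp; omega
        simp only [hΨ, h1, dite_false, h2, hg2 v h3]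
  · -- the summands agree
    rw [← Multiset.prod_coe, ← Multiset.map_coe, ← Multiset.map_coe, Multiset.coe_toList,
      Multiset.map_map]
    congr 1
    refine Multiset.map_congr rfl fun e _ => ?_
    simp only [Function.comp_apply]
    rw [hΨ1, hΨ2]
    congr 1
    exact Prod.ext (Fin.ext (Nat.mod_eq_of_lt (h.1 e.1).isLt).symm)
      (Fin.ext (Nat.mod_eq_of_lt (h.2 e.2).isLt).symm)

/-! ### Step 4: closing, and the normalising constant -/

/-- **Homomorphism polynomials of patterns of treewidth `≤ w` are closed labelled pattern expressions
with `w + 1` row and `w + 1` column labels** (any larger numbers of labels, any field of characteristic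
`0`, `n ≥ 1`). [folklore] -/
theorem exists_close_eq_homPoly {F : Type} [Field F] [CharZero F] {a b w : ℕ}
    (E : Multiset (Fin a × Fin b))
    (htw : treewidth (SimpleGraph.fromRel fun u v : Fin a ⊕ Fin b =>
      ∃ e ∈ E, u = Sum.inl e.1 ∧ v = Sum.inr e.2) ≤ w)
    {n : ℕ} (hn : 1 ≤ n) {k l : ℕ} (hk : w + 1 ≤ k) (hl : w + 1 ≤ l) :
    ∃ e : PatternExpr F k l, e.close n = homPoly E n F := by
  classical
  have hn0 : 0 < n := hn
  -- step 0: a rooted tree decomposition in list form, vertices `inl p ↦ p`, `inr q ↦ a + q`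
  obtain ⟨par, bags, hD, hadj, hw⟩ := exists_isRootedTD_of_treewidth_le (finSumFinEquiv) htw
  -- step 1: a bag-injective labelling with labels `≤ w`
  obtain ⟨lab, hlab, hinj⟩ := exists_bag_labelling hD hw
  -- the coded edges
  set es : List (ℕ × ℕ) := E.toList.map fun e : Fin a × Fin b => ((e.1 : ℕ), a + (e.2 : ℕ)) with hes_def
  have hes : ∀ e ∈ es, e.1 < a ∧ ¬ e.2 < a := by
    intro e he
    obtain ⟨e', -, rfl⟩ := List.mem_map.1 he
    exact ⟨e'.1.isLt, by omega⟩
  have hcov : ∀ e ∈ es, ∃ t, t < bags.length ∧ e.1 ∈ bagOf bags t ∧ e.2 ∈ bagOf bags t := by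
    intro e he
    obtain ⟨e', he', rfl⟩ := List.mem_map.1 he
    have hadj' : (SimpleGraph.fromRel fun u v : Fin a ⊕ Fin b =>
        ∃ e ∈ E, u = Sum.inl e.1 ∧ v = Sum.inr e.2).Adj (Sum.inl e'.1) (Sum.inr e'.2) := by
      rw [SimpleGraph.fromRel_adj]
      exact ⟨Sum.inl_ne_inr, Or.inl ⟨e', Multiset.mem_toList.1 he', rfl, rfl⟩⟩
    obtain ⟨t, ht, h1, h2⟩ := hadj _ _ hadj'
    refine ⟨t, ht, ?_, ?_⟩
    · simpa [finSumFinEquiv_apply_left] using h1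
    · simpa [finSumFinEquiv_apply_right] using h2
  -- step 2: the expression with constant value
  obtain ⟨ex, hex⟩ := exists_patternExpr_value_eq_sum (F := F) hn0 a k l (a + b) hD lab
    (fun v => lt_of_le_of_lt (hlab v) (by omega)) (fun v => lt_of_le_of_lt (hlab v) (by omega))
    hinj es hes hcov
  -- step 3: that value is `hom_{E,n}`
  have hval : ∀ (ρ : Fin k → Fin n) (γ : Fin l → Fin n), ex.value n ρ γ = homPoly E n F := by
    intro ρ γ
    rw [hex ρ γ, hes_def]
    exact sum_assignments_eq_homPoly hn0 a b E
  -- step 4: close and normalise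
  have hnF : (n : F) ≠ 0 := Nat.cast_ne_zero.2 (by omega)
  refine ⟨PatternExpr.mul (PatternExpr.const (((n : F) ^ (k + l))⁻¹)) ex, ?_⟩
  simp only [PatternExpr.close, PatternExpr.value_mul, PatternExpr.value_const, hval,
    Finset.sum_const, Finset.card_univ, Fintype.card_fun, Fintype.card_fin, nsmul_eq_mul,
    Nat.cast_pow]
  rw [← map_natCast (C : F →+* MvPolynomial (Fin n × Fin n) F) n, ← mul_assoc, ← mul_assoc,
    ← map_pow, ← map_pow, ← map_mul, ← map_mul]
  have : (n : F) ^ k * (n : F) ^ l * ((n : F) ^ (k + l))⁻¹ = 1 := by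
    rw [← pow_add, mul_inv_cancel₀ (pow_ne_zero _ hnF)]
  rw [this, map_one, one_mul]

/-! ### K2 verbatim, and the crux from K1 alone -/

/-- **K2 — `stub_homPoly_close` of line `narrow-expansion` (archived stub of crux
stmt-ValiantsHypothesis-18293), verbatim, PROVED**: a bipartite pattern of treewidth `≤ w` is, for
`n ≥ 1` and all `k, l ≥ w + 1`, the closed polynomial of a labelled pattern expression over `ℂ` with
`k` row and `l` column labels. [folklore] -/
theorem stub_homPoly_close :
    ∀ (a b w : ℕ) (E : Multiset (Fin a × Fin b)),
      Literature.Combinatorics.SimpleGraph.treewidth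
          (SimpleGraph.fromRel fun u v : Fin a ⊕ Fin b =>
            ∃ e ∈ E, u = Sum.inl e.1 ∧ v = Sum.inr e.2) ≤ w →
      ∀ n : ℕ, 1 ≤ n → ∀ k l : ℕ, w + 1 ≤ k → w + 1 ≤ l →
        ∃ e : PatternExpr ℂ k l, e.close n = homPoly E n ℂ :=
  fun _ _ _ E htw _ hn _ _ hk hl => exists_close_eq_homPoly E htw hn hk hl

/-- **The crux from K1 alone.** With K2 (`stub_homPoly_close`, this file) and K3 (`stub_close_orbit`)
proved, the counting-width split `orbitRestorationQP_of_narrowExpansion` of the crux `OrbitRestorationQP`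
(stmt-ValiantsHypothesis-18293) has the single remaining binder K1 = `NarrowExpansionVP` (verbatim below:
every matrix-symmetric `VP` family lies, for every `n`, in the `ℂ`-span of the homomorphism polynomials
of bipartite patterns of treewidth `≤ (log₂ n + c)^c`; conjecture-grade). VP ≠ VNP is not moved.
[folklore] -/
theorem orbitRestorationQP_of_narrowExpansionVP :
    (∀ f : (n : ℕ) → MvPolynomial (Fin n × Fin n) ℂ,
      (∀ (n : ℕ) (σ τ : Equiv.Perm (Fin n)),
        MvPolynomial.rename (fun p : Fin n × Fin n => (σ p.1, τ p.2)) (f n) = f n) →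
      IsVPFamily f →
      ∃ c : ℕ, ∀ n : ℕ, f n ∈ Submodule.span ℂ
        {p : MvPolynomial (Fin n × Fin n) ℂ | ∃ (a b : ℕ) (E : Multiset (Fin a × Fin b)),
          Literature.Combinatorics.SimpleGraph.treewidth
              (SimpleGraph.fromRel fun u v : Fin a ⊕ Fin b =>
                ∃ e ∈ E, u = Sum.inl e.1 ∧ v = Sum.inr e.2) ≤ (Nat.log 2 n + c) ^ c ∧
            p = homPoly E n ℂ}) →
    Summit.ValiantsHypothesis.ValiantsHypothesis.Theses.MonotoneRestoration.OrbitRestorationQP :=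
  fun h₁ => orbitRestorationQP_of_narrowExpansion_of_homPolyClose h₁ stub_homPoly_close

end Summit.ValiantsHypothesis.ValiantsHypothesis.Theorems.OrbitRestorationQPHomPolyClose

end
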